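import Summits.Parity.GeneralizedHardyLittlewood.Theses.PrimeDeterminantCells

/-!
# Crux `CentralCellsDimOne` (stmt-Parity-9537; route `PrimeDeterminantCells`, rank 2) — BIRTH SKELETON
# `Lines/birth.lean` (BC3): "sieve model on every coordinate, then swap the coordinates back one at a
# time" (hybrid / telescoping line; the open content is ONE named bilinear statement per coordinate)

planner-skel-stmt-Parity-9537-0 (skeleton registrar, one-shot; route re-audit bin REPAIRABLE),
2026-08-17. Target: the route decl
`Summit.Parity.GeneralizedHardyLittlewood.Theses.PrimeDeterminantCells.CentralCellsDimOne` BY NAME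
(rev 9 of the route file), concluded by `CentralCellsDimOne_of` from four named stubs;
`CentralCellsDimOne_proof` cites the registered stubs by name (it depends on `sorryAx` only through
them).

## The crux (fixed; not restated)

For all `t ≥ 1`, `L`, `ε > 0` there is `N₀` such that for `N ≥ N₀`, every non-degenerate `d = 1`
system `Ψ = (ψ₁,…,ψ_t)` of affine forms with `‖Ψ‖_N ≤ L` and every convex `K ⊆ [−N,N]`:
`|Σ_{n ∈ K∩ℤ} Π_i W(ψ_i(n)) − (1/3)^t (log N)^t · β_∞(Ψ,K) · Π_p β_p(Ψ)| ≤ ε N (log N)^t`, where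
`W(m) = Σ_{ab = m, m^{1/3} ≤ a ≤ m^{2/3}} Λ(a)Λ(b)` is the CENTRAL DETERMINANT CELL weight (balanced
products of two primes, `m ≤ 0 ↦ 0`), `β_∞ = archFactor`, `Π_p β_p = singularProduct`.

## The line: sieve model ⊕ one-coordinate swaps (hybrid argument)

Every proof of a Hardy–Littlewood-type asymptotic separates the CONSTANT (archimedean factor ×
singular series, carried by a computable model) from the DISCREPANCY (the arithmetic sequence is
distributed like its model along the configuration). Here the model of `W` at scale `N` is the
normalised rough-number weight

  `W♭_N(m) = (1/3)·log N · Λ_z(m)`,  `Λ_z(m) = 1_{m > 0, p ∤ m ∀ p ≤ z} · Π_{p ≤ z} p/(p−1)`,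
  `z = z(N) = ⌊exp √(log N)⌋₊`

(`(1/3) log N` is the mean of `W` on `[1, N]`: `Σ_{m ≤ x} W(m) ∼ (1/3) x log x`; `Λ_z` has mean `1`
and the local densities of the primes at every `p ≤ z`; `log z = √(log N) = o(log N)` keeps the
fundamental lemma asymptotic while `z → ∞` faster than any power of `log N` makes the truncated
singular product converge UNIFORMLY over systems of size `≤ L` — see stub S2). For `0 ≤ j ≤ t` the
HYBRID cell sum `H_j = Σ_{n ∈ K∩ℤ} Π_{i<j} W♭_N(ψ_i(n)) · Π_{i≥j} W(ψ_i(n))` interpolates between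
the crux's cell sum `H_0` and the pure model sum `H_t = ((1/3) log N)^t Σ_{n} Π_i Λ_z(ψ_i(n))`, and
`H_j − H_{j+1} = Σ_n [Π_{i<j} W♭_N(ψ_i n)] · (W − W♭_N)(ψ_j n) · [Π_{i>j} W(ψ_i n)]` is ONE bilinear
form: the balanced two-prime convolution `Λ·1_window ⋆ Λ` minus its model, composed with the affine
form `ψ_j`, against a product weight on the other coordinates. The four stubs:

* `stub_sieveModelMainTerm` (S1 — the CONSTANT; provable now, L/XL in Lean): the fundamental lemma
  of the (`t`-dimensional, combinatorial) sieve along a one-parameter affine system, uniformly: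
  `|Σ_{n ∈ K∩ℤ} Π_i Λ_z(ψ_i(n)) − archFactor Ψ K · singularProductPartial Ψ z| ≤ ε N`. Main term:
  `#(K⁺∩ℤ)·Π_{p ≤ z}(1 − ρ(p)/p)(1 − 1/p)^{−t}·(1 + O(e^{−s}))`, `s = log D/log z`, `D = N^{1/2}`,
  and `(1 − ρ(p)/p)(p/(p−1))^t` IS `localFactor Ψ p` at `d = 1`; short `K` (`|K| ≤ N/(log N)^A`) by
  the upper-bound sieve / trivial bound. [FriedlanderIwaniec2010 (Opera de Cribro) §6.5 Cor. 6.10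
  (fundamental lemma); HalberstamRichert1974 Thm 2.5; GreenTao2010 (1.6)–(1.7) for β_p]
* `stub_singularSeriesTruncation` (S2 — provable now, M/L): uniformly over non-degenerate `d = 1`
  systems of `t` forms with `‖Ψ‖_N ≤ L`, `|Π_{p ≤ z(N)} β_p − Π_p β_p| ≤ ε` for `N ≥ N₀(t,L,ε)`.
  Why true: for `p > z ≥ L` every form has one root mod `p`, so `β_p = (p/(p−1))^t (1 − r_p/p)` with
  `1 ≤ r_p ≤ t`, `r_p = t` unless `p` divides `R = Π_{i<j}(a_i b_j − a_j b_i) ≠ 0` (non-degeneracy),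
  `|R| ≤ (2L²N)^{t²}`; hence `|log Π_{p>z} β_p| ≤ t³ log(2L²N)/(z log z) + O(t²/z)` and
  `Π_{p≤z} β_p ≤ (C log z)^t`, so the error is `≤ (C √log N)^t · t³ √(log N) · e^{−√log N} → 0`.
  (With `z = log N` instead the statement would be FALSE at `t = 2`: shifts `b = (primorial) ×
  (primes in [z,2z])` keep the absolute error `≍ 1` — the reason for the choice of `z`.)
  [GreenTao2010 Lemma 1.3; Gallagher1976 (singular series on average); tree:
  `Literature.NumberTheory.Sieve.tendsto_singularProductPartial` is the NON-uniform named fact]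
* `stub_lastCoordinateSwap` (S3 — provable in principle, XL): `|H_{t−1} − H_t| ≤ ε N (log N)^t`:
  balanced semiprimes `W ∘ ψ_{t−1}` against PURE SIEVE-MODEL weights on the other `t − 1` forms are
  distributed like their model. Inputs: Bombieri–Vinogradov (level `1/2`) for the bilinear form
  `Λ·1_{[m^{1/3},m^{2/3}]} ⋆ Λ` in arithmetic progressions (both factors `≥ N^{1/3}`: large sieve +
  Siegel–Walfisz, Motohashi's induction), differenced over the two endpoints of `K⁺` when
  `|K| ≥ N/(log N)^A`; the `(t−1)`-dimensional fundamental lemma with these `A_d`; Selberg/Brun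
  upper-bound sieve for shorter `K`. This is the `t = 1` case of the crux when `t = 1` (PNT in APs
  for balanced semiprimes, Siegel–Walfisz uniformity in shifts `≤ LN`) — the refuters' "t = 1 is
  TRUE and provable" note (g41-6) is exactly S1+S2+S3 at `t = 1`.
  [Motohashi1976; BombieriFriedlanderIwaniecActa1986 Thm 0 (bilinear BV); IwaniecKowalski2004 Thm 17.4;
  FriedlanderIwaniec2010 Cor. 6.10]
* `stub_mixedCoordinateSwap` (S4 — THE LOAD-BEARING STUB; open, parity-sensitive, Type II): for
  every `j` with `j + 1 < t`, `|H_j − H_{j+1}| ≤ ε N (log N)^t`: the bilinear form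
  `Σ_{a,b} Λ(a)Λ(b)1_{win} F_j(n(ab))` (minus model) with `F_j = Π_{i<j} W♭_N(ψ_i ·)·Π_{i>j} W(ψ_i ·)`
  containing AT LEAST ONE genuine prime-pair weight `W(ψ_i n)`, `i > j`. At `t = 2`, `j = 0`,
  `Ψ = (n, n+2)` this is (given S1–S3) the twin cell `Σ W(n)W(n+2) ∼ (1/9)𝔖 x log²x` = the route's
  `CentralPrimeDeterminant`: "Type II for E₂ − h" (Harman 2007 p. 286 shape), both variables in
  `[N^{1/3}, N^{2/3}]` so that every Heath-Brown corner is a dispersion problem with a free balanced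
  cofactor — the route's TWO-LAYER PLAN child `TypeTwoPart`, now typed. Why it might fail: per system
  the dispersion (Cauchy in `a`) leaves correlations of `F_j` along pairs of progressions with moduli
  `a a' ≤ N^{4/3}` — prime pairs on lines over a 2-parameter family; no family-averaged HL of that
  strength is known (DFI 1997's saving reaches moduli products `≤ x^{1+1/40}`).
  [DukeFriedlanderIwaniec1997 Thm 2; BombieriFriedlanderIwaniecActa1986; Harman2007 §10;
  MatomakiRadziwillTao2019 (averaged HL); Evans2022 (E₂ correlations on average)]

COMPOSITION `CentralCellsDimOne_of : S1 → S2 → S3 → S4 → CentralCellsDimOne` (real proof, no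
`sorry`): telescoping `H_0 − H_t = Σ_{j<t} (H_j − H_{j+1})` (S4 for `j + 1 < t`, S3 for `j = t−1`,
each at `ε/(4t)`), `H_t = ((1/3) log N)^t · Σ_n Π_i Λ_z(ψ_i n)` (definitional bookkeeping), S1 at
`ε/4` times `((1/3) log N)^t ≤ (log N)^t`, and S2 at `ε/8` times `((1/3) log N)^t · archFactor ≤
(log N)^t · 2N` (`archFactor Ψ K ≤ vol [−N,N] = 2N`, proved here from `Real.volume_Icc_pi_toReal`).
Every stub is consumed; no stub alone meets the crux (S1/S2 carry no cell, S3/S4 carry no constant).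

WHAT THE CUT BUYS. The constant `(1/3)^t (log N)^t β_∞ Π β_p` — where every normalisation slip of
this route has lived so far (refuter reviews: `2C₂` vs `4C₂`, window mass `1/3`, the false
full-window sibling ConvMomentLevelOne 9541) — is confined to S1+S2, two PROVABLE statements a
refuter can also test numerically system by system; the parity content is confined to the
constant-free, single-coordinate bilinear statements S3 (provable: pure sieve weights opposite) and
S4 (open: a genuine prime-pair weight opposite), which is the form dispersion technology consumes
(sequence vs. model in the same bilinear sum). Killing S4 at one system (e.g. a certified bias of
`Σ_n (W − W♭_N)(n)·W(n+2)` of size `≫ N log² N`) kills the crux given S1–S3; proving S4 for `t = 2`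
alone already yields the twin cell `CentralPrimeDeterminant` (with S1–S3 at `t = 2`).

## BC3 probes (registrar folder `bc/probe_crux.lean`, `bc/probe_summit.lean`: the vocabulary and
## the four stub STATEMENTS only in scope — no stub theorem, no composition)

For each stub `S ∈ {S1, S2, S3, S4}`: `S → CentralCellsDimOne` and `S → GeneralizedHardyLittlewood`
by each of `exact?`, `simpa`, `aesop` as separate examples (`set_option maxHeartbeats 400000`; run
separately because a heartbeat timeout inside `first | … |` aborts the remaining alternatives):
24/24 FAIL — `exact?`: "could not close the goal"; `simpa`: "Tactic `assumption` failed"; `aesop`: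
"failed to prove the goal after exhaustive search" (lean check rc 1, 134 s + 128 s). A first combined
run `first | exact? | simpa | simpa [S] | (unfold S; simpa) | aesop` against the crux also failed
4/4 (S1/S3 by heartbeat timeout inside `simpa [S]`, S2/S4 unsolved goals). Table: `Lines/birth.md`.

## Disproof used / dead lines / negatives

None exist for this crux (2026-08-17): `ledger crux ls stmt-Parity-9537` — no workfiles, no
`Disproof.lean`, no `_false_without_` theorem, no `Theorems/CentralCellsDimOne/Negative/*`. Parity
negatives index (3 entries): ConvMomentLevelOne (stmt-Parity-9541, this route's dropped support: the
FULL convolution `Λ ⋆ Λ` on odd `m` has secondary main terms at odd prime moduli) — no stub here uses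
a full-window convolution or a level-of-distribution claim with a specified main term beyond the
model's; TupleElliott (stmt-Parity-14832) and rectangle-Chowla (stmt-Parity-4218) are unrelated
shapes. Refuter notes on the item (g41-6: "t = 1 TRUE, PNT-in-APs level"; g40-31/g41-22: faithful
typing, toNat/positivity conventions) are honoured: positivity `0 < m` is built into `Λ_z`, matching
`archFactor`'s positivity region and `W(m ≤ 0) = 0`.

Sources: GreenTao2010 (Conj. 1.2, Lemma 1.3, (1.4)–(1.7)); FriedlanderIwaniec2010 §6.5;
HalberstamRichert1974 Thm 2.5; Motohashi1976; BombieriFriedlanderIwaniecActa1986;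
DukeFriedlanderIwaniec1997; Harman2007 §10; MatomakiRadziwillTao2019; Evans2022 (arXiv:2102.12297).
-/

noncomputable section

namespace Summit.Parity.GeneralizedHardyLittlewood.Cruxes.CentralCellsDimOne.Birth

open scoped BigOperators Classical
open Filter Literature.NumberTheory.Sieve

/-! ## Vocabulary -/

/-- The central determinant cell weight `W(m) = Σ_{ab = m, m^{1/3} ≤ a ≤ m^{2/3}} Λ(a)Λ(b)` —
VERBATIM the crux's inner sum (as a function of `m = (ψ_i(n)).toNat`; `W(0) = W(1) = 0`).
[cite: BombieriRIMS1977, p. 7] -/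
def cellWeight (m : ℕ) : ℝ :=
  ∑ ab ∈ (Nat.divisorsAntidiagonal m).filter (fun ab : ℕ × ℕ =>
      ((m : ℕ) : ℝ) ^ (1 / 3 : ℝ) ≤ (ab.1 : ℝ) ∧ (ab.1 : ℝ) ≤ ((m : ℕ) : ℝ) ^ (2 / 3 : ℝ)),
    ArithmeticFunction.vonMangoldt ab.1 * ArithmeticFunction.vonMangoldt ab.2

/-- The sieve level `z(N) = ⌊exp √(log N)⌋₊` (`log z = √log N = o(log N)`, `z ≫ (log N)^A`).
[folklore] -/
def sieveLevel (N : ℕ) : ℕ :=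
  ⌊Real.exp (Real.sqrt (Real.log (N : ℝ)))⌋₊

/-- The normalised rough-number model `Λ_z(m) = 1_{m > 0, p ∤ m ∀ p ≤ z} · Π_{p ≤ z} p/(p−1)` at
`z = z(N)` (mean `1`; the local densities of the primes at every `p ≤ z`; `0` on `m ≤ 0`).
[cite: GreenTao2010, (1.5)] -/
def roughModel (N : ℕ) (m : ℤ) : ℝ :=
  if 0 < m ∧ ∀ p ∈ Nat.primesLE (sieveLevel N), ¬ ((p : ℤ) ∣ m) then
    ∏ p ∈ Nat.primesLE (sieveLevel N), ((p : ℝ) / ((p : ℝ) - 1))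
  else 0

/-- The model cell weight `W♭_N(m) = (1/3) · log N · Λ_z(m)` (`(1/3) log N` = the mean of `W` on
`[1, N]`). [folklore] -/
def modelWeight (N : ℕ) (m : ℤ) : ℝ :=
  (1 / 3 : ℝ) * Real.log (N : ℝ) * roughModel N m

/-- The hybrid product at position `j`: model weights on the coordinates `i < j`, the true cell
weights on the coordinates `i ≥ j` (`j = 0`: the crux's product; `j = t`: the pure model). [folklore] -/
def hybrid {t : ℕ} (Ψ : Fin t → AffLinForm 1) (N j : ℕ) (n : Fin 1 → ℤ) : ℝ :=
  ∏ i : Fin t, if (i : ℕ) < j then modelWeight N ((Ψ i).eval n) else cellWeight ((Ψ i).eval n).toNat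

/-- The hybrid cell sum `H_j = Σ_{n ∈ K ∩ ℤ} hybrid_j(n)` over the lattice points of `[−N,N]` in `K`
(the crux's range of summation, verbatim). [folklore] -/
def hybridSum {t : ℕ} (Ψ : Fin t → AffLinForm 1) (K : Set (Fin 1 → ℝ)) (N j : ℕ) : ℝ :=
  ∑ n ∈ (latticeBox 1 N).filter (fun n => realPoint n ∈ K), hybrid Ψ N j n

/-! ## Stub statements (named `Sig.stub_*` so that the skeleton theorem's hypotheses are the
registered obligations by name) -/

/-- STUB S1 — SIEVE-MODEL MAIN TERM (fundamental lemma along one-parameter affine systems;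
PROVABLE NOW, L/XL): uniformly over non-degenerate `d = 1` systems of `t` forms with `‖Ψ‖_N ≤ L` and
convex `K ⊆ [−N,N]`, `|Σ_{n ∈ K∩ℤ} Π_i Λ_z(ψ_i(n)) − archFactor Ψ K · Π_{p ≤ z} β_p| ≤ ε N`,
`z = z(N)`. Constant-bearing, parity-free. [cite: GreenTao2010, (1.6)–(1.7); FriedlanderIwaniec2010, Cor. 6.10] -/
def Sig.stub_sieveModelMainTerm : Prop :=
  ∀ (t L : ℕ), 1 ≤ t → ∀ ε : ℝ, 0 < ε → ∃ N₀ : ℕ, ∀ N : ℕ, N₀ ≤ N →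
    ∀ Ψ : Fin t → AffLinForm 1, IsNondegenerateSystem Ψ → affLinSize Ψ N ≤ L →
      ∀ K : Set (Fin 1 → ℝ), Convex ℝ K → K ⊆ realBox 1 N →
        |(∑ n ∈ (latticeBox 1 N).filter (fun n => realPoint n ∈ K),
            ∏ i, roughModel N ((Ψ i).eval n)) -
          archFactor Ψ K * singularProductPartial Ψ (sieveLevel N)| ≤ ε * (N : ℝ)

/-- STUB S2 — UNIFORM TRUNCATION OF THE SINGULAR PRODUCT (PROVABLE NOW, M/L): uniformly over
non-degenerate `d = 1` systems of `t` forms with `‖Ψ‖_N ≤ L`,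
`|Π_{p ≤ z(N)} β_p − Π_p β_p| ≤ ε` for `N ≥ N₀(t, L, ε)` (error
`≤ (C√log N)^t · t³ √(log N) · e^{−√log N}`; false with `z = log N`). [cite: GreenTao2010, Lemma 1.3] -/
def Sig.stub_singularSeriesTruncation : Prop :=
  ∀ (t L : ℕ), 1 ≤ t → ∀ ε : ℝ, 0 < ε → ∃ N₀ : ℕ, ∀ N : ℕ, N₀ ≤ N →
    ∀ Ψ : Fin t → AffLinForm 1, IsNondegenerateSystem Ψ → affLinSize Ψ N ≤ L →
      |singularProductPartial Ψ (sieveLevel N) - singularProduct Ψ| ≤ ε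

/-- STUB S3 — LAST-COORDINATE SWAP (balanced semiprimes against pure sieve-model weights;
PROVABLE IN PRINCIPLE, XL: Bombieri–Vinogradov for `Λ·1_window ⋆ Λ` + fundamental lemma in dimension
`t − 1` + upper-bound sieve for short `K`): `|H_{t−1} − H_t| ≤ ε N (log N)^t` uniformly.
[cite: Motohashi1976; BombieriFriedlanderIwaniecActa1986, Thm 0] -/
def Sig.stub_lastCoordinateSwap : Prop :=
  ∀ (t L : ℕ), 1 ≤ t → ∀ ε : ℝ, 0 < ε → ∃ N₀ : ℕ, ∀ N : ℕ, N₀ ≤ N →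
    ∀ Ψ : Fin t → AffLinForm 1, IsNondegenerateSystem Ψ → affLinSize Ψ N ≤ L →
      ∀ K : Set (Fin 1 → ℝ), Convex ℝ K → K ⊆ realBox 1 N →
        |hybridSum Ψ K N (t - 1) - hybridSum Ψ K N t| ≤ ε * (N : ℝ) * Real.log N ^ t

/-- STUB S4 — MIXED-COORDINATE SWAPS (THE LOAD-BEARING, OPEN, PARITY-SENSITIVE TYPE-II STATEMENT):
for every position `j` with `j + 1 < t` (so at least one genuine prime-pair weight `W(ψ_i n)`,
`i > j`, stands opposite), `|H_j − H_{j+1}| ≤ ε N (log N)^t` uniformly. At `t = 2`, `Ψ = (n, n+2)`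
it is the twin cell (`CentralPrimeDeterminant`) in sequence-vs-model form.
[cite: DukeFriedlanderIwaniec1997, Thm 2; Harman2007, §10.6] -/
def Sig.stub_mixedCoordinateSwap : Prop :=
  ∀ (t L : ℕ), 1 ≤ t → ∀ ε : ℝ, 0 < ε → ∃ N₀ : ℕ, ∀ N : ℕ, N₀ ≤ N →
    ∀ Ψ : Fin t → AffLinForm 1, IsNondegenerateSystem Ψ → affLinSize Ψ N ≤ L →
      ∀ K : Set (Fin 1 → ℝ), Convex ℝ K → K ⊆ realBox 1 N →
        ∀ j : ℕ, j + 1 < t →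
          |hybridSum Ψ K N j - hybridSum Ψ K N (j + 1)| ≤ ε * (N : ℝ) * Real.log N ^ t

/-! ## Registered stubs (the ONLY `sorry`s of this file) -/

/-- Registered stub S1 (sieve-model main term along `d = 1` systems). -/
theorem stub_sieveModelMainTerm : Sig.stub_sieveModelMainTerm := by
  sorry

/-- Registered stub S2 (uniform truncation of the singular product at `z(N)`). -/
theorem stub_singularSeriesTruncation : Sig.stub_singularSeriesTruncation := by
  sorry

/-- Registered stub S3 (last-coordinate swap against pure sieve weights). -/
theorem stub_lastCoordinateSwap : Sig.stub_lastCoordinateSwap := by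
  sorry

/-- Registered stub S4 (mixed-coordinate swaps: the Type-II heart). -/
theorem stub_mixedCoordinateSwap : Sig.stub_mixedCoordinateSwap := by
  sorry

/-! ## Bookkeeping lemmas for the composition (sorry-free) -/

/-- `H_0` is the crux's cell sum (no coordinate is modelled). [folklore] -/
theorem hybridSum_zero {t : ℕ} (Ψ : Fin t → AffLinForm 1) (K : Set (Fin 1 → ℝ)) (N : ℕ) :
    hybridSum Ψ K N 0 =
      ∑ n ∈ (latticeBox 1 N).filter (fun n => realPoint n ∈ K),
        ∏ i, cellWeight ((Ψ i).eval n).toNat := by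
  unfold hybridSum hybrid
  simp

/-- `H_t` is the pure model sum: `((1/3) log N)^t · Σ_n Π_i Λ_z(ψ_i(n))`. [folklore] -/
theorem hybridSum_self {t : ℕ} (Ψ : Fin t → AffLinForm 1) (K : Set (Fin 1 → ℝ)) (N : ℕ) :
    hybridSum Ψ K N t =
      ((1 / 3 : ℝ) * Real.log (N : ℝ)) ^ t *
        ∑ n ∈ (latticeBox 1 N).filter (fun n => realPoint n ∈ K),
          ∏ i, roughModel N ((Ψ i).eval n) := by
  unfold hybridSum hybrid modelWeight
  rw [Finset.mul_sum]
  refine Finset.sum_congr rfl fun n _ => ?_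
  have h : ∀ i : Fin t, (if (i : ℕ) < t then (1 / 3 : ℝ) * Real.log (N : ℝ) * roughModel N ((Ψ i).eval n)
      else cellWeight ((Ψ i).eval n).toNat) =
      ((1 / 3 : ℝ) * Real.log (N : ℝ)) * roughModel N ((Ψ i).eval n) := fun i => by
    rw [if_pos i.is_lt]
  rw [Finset.prod_congr rfl fun i _ => h i, Finset.prod_mul_distrib, Finset.prod_const,
    Finset.card_univ, Fintype.card_fin]

/-- The archimedean factor of a body inside `[−N, N]` is at most `vol [−N, N] = 2N`.
[cite: GreenTao2010, (1.4)] -/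
theorem archFactor_le_two_mul {t : ℕ} (Ψ : Fin t → AffLinForm 1) {K : Set (Fin 1 → ℝ)} {N : ℕ}
    (hK : K ⊆ realBox 1 N) : archFactor Ψ K ≤ 2 * (N : ℝ) := by
  unfold archFactor
  have hsub : K ∩ {x | ∀ i, 0 < (Ψ i).realEval x} ⊆
      Set.Icc (fun _ : Fin 1 => -(N : ℝ)) (fun _ => (N : ℝ)) :=
    fun x hx => hK hx.1
  have hle : (fun _ : Fin 1 => -(N : ℝ)) ≤ (fun _ => (N : ℝ)) := fun _ => by
    have : (0 : ℝ) ≤ N := Nat.cast_nonneg N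
    linarith
  have hvol : (MeasureTheory.volume (Set.Icc (fun _ : Fin 1 => -(N : ℝ)) (fun _ => (N : ℝ)))).toReal
      = 2 * (N : ℝ) := by
    rw [Real.volume_Icc_pi_toReal hle]
    simp
    ring
  have hfin : MeasureTheory.volume (Set.Icc (fun _ : Fin 1 => -(N : ℝ)) (fun _ => (N : ℝ))) ≠ ⊤ := by
    rw [Real.volume_Icc_pi]
    exact ENNReal.prod_ne_top fun _ _ => ENNReal.ofReal_ne_top
  calc (MeasureTheory.volume (K ∩ {x | ∀ i, 0 < (Ψ i).realEval x})).toReal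
      ≤ (MeasureTheory.volume (Set.Icc (fun _ : Fin 1 => -(N : ℝ)) (fun _ => (N : ℝ)))).toReal :=
        ENNReal.toReal_mono hfin (MeasureTheory.measure_mono hsub)
    _ = 2 * (N : ℝ) := hvol

/-! ## The composition: the four stubs imply the crux, by name -/

/-- **THE SKELETON THEOREM.** `S1 → S2 → S3 → S4 →
Summit.Parity.GeneralizedHardyLittlewood.Theses.PrimeDeterminantCells.CentralCellsDimOne`, a real
proof (no `sorry`): telescoping over the coordinates (S4 for `j + 1 < t`, S3 for `j = t − 1`, at
`ε/(4t)` each), the model identity `H_t = ((1/3) log N)^t Σ Π Λ_z`, S1 at `ε/4`, S2 at `ε/8` with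
`archFactor ≤ 2N` and `((1/3) log N)^t ≤ (log N)^t`. Every stub is consumed. [folklore] -/
theorem CentralCellsDimOne_of :
    Sig.stub_sieveModelMainTerm → Sig.stub_singularSeriesTruncation →
    Sig.stub_lastCoordinateSwap → Sig.stub_mixedCoordinateSwap →
      Summit.Parity.GeneralizedHardyLittlewood.Theses.PrimeDeterminantCells.CentralCellsDimOne := by
  intro h1 h2 h3 h4 t L ht ε hε
  have htpos : (0 : ℝ) < (t : ℝ) := by exact_mod_cast ht
  obtain ⟨N₁, hN₁⟩ := h1 t L ht (ε / 4) (by positivity)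
  obtain ⟨N₂, hN₂⟩ := h2 t L ht (ε / 8) (by positivity)
  obtain ⟨N₃, hN₃⟩ := h3 t L ht (ε / (4 * t)) (by positivity)
  obtain ⟨N₄, hN₄⟩ := h4 t L ht (ε / (4 * t)) (by positivity)
  refine ⟨max (max N₁ N₂) (max N₃ N₄), fun N hN Ψ hΨ hL K hK hKN => ?_⟩
  have hN1 : N₁ ≤ N := le_trans (le_trans (le_max_left _ _) (le_max_left _ _)) hN
  have hN2 : N₂ ≤ N := le_trans (le_trans (le_max_right _ _) (le_max_left _ _)) hN
  have hN3 : N₃ ≤ N := le_trans (le_trans (le_max_left _ _) (le_max_right _ _)) hN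
  have hN4 : N₄ ≤ N := le_trans (le_trans (le_max_right _ _) (le_max_right _ _)) hN
  -- positivity facts
  have hlog : 0 ≤ Real.log (N : ℝ) := Real.log_natCast_nonneg N
  have hNnn : (0 : ℝ) ≤ (N : ℝ) := Nat.cast_nonneg N
  have hE : 0 ≤ (N : ℝ) * Real.log N ^ t := by positivity
  have hc0 : 0 ≤ (1 / 3 : ℝ) * Real.log (N : ℝ) := by positivity
  have hct : ((1 / 3 : ℝ) * Real.log (N : ℝ)) ^ t ≤ Real.log (N : ℝ) ^ t := by
    apply pow_le_pow_left₀ hc0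
    linarith
  have hA0 : 0 ≤ archFactor Ψ K := ENNReal.toReal_nonneg
  have hA : archFactor Ψ K ≤ 2 * (N : ℝ) := archFactor_le_two_mul Ψ hKN
  -- the four stub instances
  have hmodel := hN₁ N hN1 Ψ hΨ hL K hK hKN
  have htrunc := hN₂ N hN2 Ψ hΨ hL
  have hstep : ∀ j ∈ Finset.range t,
      |hybridSum Ψ K N j - hybridSum Ψ K N (j + 1)| ≤ ε / (4 * t) * (N : ℝ) * Real.log N ^ t := by
    intro j hj
    rw [Finset.mem_range] at hj
    rcases Nat.lt_or_ge (j + 1) t with hlt | hge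
    · exact hN₄ N hN4 Ψ hΨ hL K hK hKN j hlt
    · have hj1 : j + 1 = t := by omega
      have hj' : j = t - 1 := by omega
      rw [hj1, hj']
      exact hN₃ N hN3 Ψ hΨ hL K hK hKN
  -- telescoping over the coordinates
  have hswap : |hybridSum Ψ K N 0 - hybridSum Ψ K N t| ≤ ε / 4 * ((N : ℝ) * Real.log N ^ t) := by
    rw [← Finset.sum_range_sub' (fun j => hybridSum Ψ K N j) t]
    calc |∑ j ∈ Finset.range t, (hybridSum Ψ K N j - hybridSum Ψ K N (j + 1))|
        ≤ ∑ j ∈ Finset.range t, |hybridSum Ψ K N j - hybridSum Ψ K N (j + 1)| :=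
          Finset.abs_sum_le_sum_abs _ _
      _ ≤ ∑ j ∈ Finset.range t, ε / (4 * t) * (N : ℝ) * Real.log N ^ t := Finset.sum_le_sum hstep
      _ = ε / 4 * ((N : ℝ) * Real.log N ^ t) := by
          rw [Finset.sum_const, Finset.card_range, nsmul_eq_mul]
          field_simp
  -- the model main term, scaled
  have hmain : |hybridSum Ψ K N t - ((1 / 3 : ℝ) * Real.log (N : ℝ)) ^ t *
      (archFactor Ψ K * singularProductPartial Ψ (sieveLevel N))| ≤
        ε / 4 * ((N : ℝ) * Real.log N ^ t) := by
    rw [hybridSum_self, ← mul_sub, abs_mul, abs_of_nonneg (pow_nonneg hc0 t)]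
    calc ((1 / 3 : ℝ) * Real.log (N : ℝ)) ^ t *
          |(∑ n ∈ (latticeBox 1 N).filter (fun n => realPoint n ∈ K),
              ∏ i, roughModel N ((Ψ i).eval n)) -
            archFactor Ψ K * singularProductPartial Ψ (sieveLevel N)|
        ≤ Real.log (N : ℝ) ^ t * (ε / 4 * (N : ℝ)) :=
          mul_le_mul hct hmodel (abs_nonneg _) (pow_nonneg hlog t)
      _ = ε / 4 * ((N : ℝ) * Real.log N ^ t) := by ring
  -- the truncation of the singular product, scaled
  have htail : |((1 / 3 : ℝ) * Real.log (N : ℝ)) ^ t *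
      (archFactor Ψ K * singularProductPartial Ψ (sieveLevel N)) -
        ((1 / 3 : ℝ) * Real.log (N : ℝ)) ^ t * (archFactor Ψ K * singularProduct Ψ)| ≤
          ε / 4 * ((N : ℝ) * Real.log N ^ t) := by
    rw [← mul_sub, ← mul_sub, abs_mul, abs_mul, abs_of_nonneg (pow_nonneg hc0 t),
      abs_of_nonneg hA0]
    calc ((1 / 3 : ℝ) * Real.log (N : ℝ)) ^ t * (archFactor Ψ K *
          |singularProductPartial Ψ (sieveLevel N) - singularProduct Ψ|)
        ≤ Real.log (N : ℝ) ^ t * (2 * (N : ℝ) * (ε / 8)) :=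
          mul_le_mul hct (mul_le_mul hA htrunc (abs_nonneg _) (by positivity))
            (by positivity) (pow_nonneg hlog t)
      _ = ε / 4 * ((N : ℝ) * Real.log N ^ t) := by ring
  -- assemble
  have key : |hybridSum Ψ K N 0 -
      (1 / 3 : ℝ) ^ t * Real.log (N : ℝ) ^ t * (archFactor Ψ K * singularProduct Ψ)| ≤
        ε * (N : ℝ) * Real.log N ^ t := by
    have e1 : hybridSum Ψ K N 0 -
        (1 / 3 : ℝ) ^ t * Real.log (N : ℝ) ^ t * (archFactor Ψ K * singularProduct Ψ) =
        (hybridSum Ψ K N 0 - hybridSum Ψ K N t) +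
        (hybridSum Ψ K N t - ((1 / 3 : ℝ) * Real.log (N : ℝ)) ^ t *
          (archFactor Ψ K * singularProductPartial Ψ (sieveLevel N))) +
        (((1 / 3 : ℝ) * Real.log (N : ℝ)) ^ t *
          (archFactor Ψ K * singularProductPartial Ψ (sieveLevel N)) -
          ((1 / 3 : ℝ) * Real.log (N : ℝ)) ^ t * (archFactor Ψ K * singularProduct Ψ)) := by
      rw [mul_pow]; ring
    rw [e1]
    calc _ ≤ |hybridSum Ψ K N 0 - hybridSum Ψ K N t| +
          |hybridSum Ψ K N t - ((1 / 3 : ℝ) * Real.log (N : ℝ)) ^ t *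
            (archFactor Ψ K * singularProductPartial Ψ (sieveLevel N))| +
          |((1 / 3 : ℝ) * Real.log (N : ℝ)) ^ t *
            (archFactor Ψ K * singularProductPartial Ψ (sieveLevel N)) -
            ((1 / 3 : ℝ) * Real.log (N : ℝ)) ^ t * (archFactor Ψ K * singularProduct Ψ)| :=
          abs_add_three _ _ _
      _ ≤ ε / 4 * ((N : ℝ) * Real.log N ^ t) + ε / 4 * ((N : ℝ) * Real.log N ^ t) +
          ε / 4 * ((N : ℝ) * Real.log N ^ t) := add_le_add_three hswap hmain htail
      _ ≤ ε * (N : ℝ) * Real.log N ^ t := by nlinarith [hE, hε]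
  -- `H_0` is the crux's cell sum
  rw [hybridSum_zero] at key
  simpa only [cellWeight] using key

/-- The skeleton in its final shape: the crux BY NAME from the four registered stubs; it becomes the
crux proof when the last `stub_*` is discharged (until then it depends on `sorryAx` through the
stubs only — no `sorry` of its own). [folklore] -/
theorem CentralCellsDimOne_proof :
    Summit.Parity.GeneralizedHardyLittlewood.Theses.PrimeDeterminantCells.CentralCellsDimOne :=
  CentralCellsDimOne_of stub_sieveModelMainTerm stub_singularSeriesTruncation
    stub_lastCoordinateSwap stub_mixedCoordinateSwap

end Summit.Parity.GeneralizedHardyLittlewood.Cruxes.CentralCellsDimOne.Birth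

end
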